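import Summits.CriticalPhenomena.PercolationContinuityZ3.Theorems.TallClusterMassBound.Negative.MassExponentFamily
import Summits.CriticalPhenomena.PercolationContinuityZ3.Theorems.TallClusterMassBound.Negative.FalseWithoutCriticality
import Summits.CriticalPhenomena.PercolationContinuityZ3.Theorems.QuantitativeBGN.Negative.ArmLowerBound

/-!
# `TallClusterMassBound` (stmt-CriticalPhenomena-0912), line `replica-overlap-cs-transfer` —
# what is provable today around the stub `stub_wallArmLowerRegularity`

The registered stub asks for the two-scale LOWER regularity of the wall one-arm at `p_c(ℤ³)`:
`∃ C, λ < 11/4, ∀ 1 ≤ n ≤ r, π_s(n) ≤ C (r/n)^λ π_s(r)`, `π_s = armProb (criticalProbI 3)`.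
This file does NOT prove it (no 3D cross-scale/gluing engine exists in the tree; taking `r = 2n`
the stub contains the uniform doubling bound `π_s(2n) ≥ c π_s(n)`, unknown in `d = 3`). It records,
sorry-free, exactly which part of the `(n, r)`-range the one-scale tools already cover, so that the
residual open content is a precise window, plus the only gluing-free cross-scale handle available
(Harris–FKG supermultiplicativity of wall-rooted point-to-point connections).

* §1 `arm_eq_armH` (`rfl` bridge to `QuantitativeBGN.Negative.armH`), `armProb_criticalProbI_ge` :
  `π_s(r) ≥ 1/(588 r²)` for `r ≥ 1` (= `armH_lower_bound`, DCT `φ_{p_c}(Λ_r) ≥ 1` + face isomorphisms).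
* §2 the two provable slices of the stub and the reduction to the window:
  `wallArmLowerRegularity_small` (`n ≤ N₀`: constant `588 N₀²`, any exponent `λ ≥ 2`),
  `wallArmLowerRegularity_far` (`n^λ ≤ r^{λ-2}`, i.e. `r ≥ n^{λ/(λ-2)}`: constant `588`),
  `wallArmLowerRegularity_of_window` : the stub follows from its restriction to
  `N₀ ≤ n ≤ r`, `r^{λ-2} < n^λ` for some `2 ≤ λ < 11/4` — this window (which contains `r = 2n`,
  i.e. uniform doubling) is the GENUINE missing two-scale input.
* §3 `real_conn_le_real_openConnIn_shift` (translation: `P(x ↔_ℍ x+z) ≥ P(0 ↔_ℍ z)` for `x ∈ ℍ`,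
  since `x + ℍ ⊆ ℍ`), `real_conn_mul_le_real_conn_add` (Harris–FKG: `τ_ℍ(0,x) τ_ℍ(0,z) ≤ τ_ℍ(0,x+z)`
  for `x ∈ ℍ`), `real_conn_pow_le` (`τ_ℍ(0,x)^{k+1} ≤ τ_ℍ(0,(k+1)x)`), `real_conn_le_armProb`
  (`τ_ℍ(0,x) ≤ π_s(‖x‖∞)`).
-/

noncomputable section

open MeasureTheory Finset
open Literature.Probability.Percolation Literature.Probability.LatticeModels
open Summit.CriticalPhenomena.PercolationContinuityZ3.Theorems.TallClusterMassBound.Negative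
open Summit.CriticalPhenomena.PercolationContinuityZ3.Theorems.QuantitativeBGN.Negative

namespace Summit.CriticalPhenomena.PercolationContinuityZ3.Theorems.TallClusterMassBound.ReplicaOverlap

/-! ## §1 Bridge to `armH` and the one-scale lower bound in the `armProb` vocabulary -/

/-- The route's tall event `arm r` IS the disprover's `armH r` (the half-space `Hs` unfolds to
`{x | 0 ≤ x 0}`). [folklore] -/
theorem arm_eq_armH (r : ℕ) : arm r = armH r := rfl

/-- `π_s(r) = P_{p}(armH r)` verbatim. [folklore] -/
theorem armProb_eq_real_armH (p : unitInterval) (r : ℕ) :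
    armProb p r = (bondPercolation (zdGraph 3) p).real (armH r) := rfl

/-- **One-scale lower bound**: `π_s(r) ≥ 1/(588 r²)` at `p_c(ℤ³)` for every `r ≥ 1`
(`armH_lower_bound`: `φ_{p_c}(Λ_r) ≥ 1` and the face isomorphisms). [folklore] -/
theorem armProb_criticalProbI_ge {r : ℕ} (hr : 1 ≤ r) :
    1 / (588 * (r : ℝ) ^ 2) ≤ armProb (criticalProbI 3) r := by
  have hlow := armH_lower_bound (r - 1)
  have hr1 : ((r - 1 : ℕ) : ℝ) + 1 = r := by
    rw [Nat.cast_sub hr, Nat.cast_one]; ring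
  have hr2 : r - 1 + 1 = r := by omega
  rw [hr1, hr2] at hlow
  exact hlow

/-- `1 ≤ 588 r² π_s(r)` at `p_c(ℤ³)`, `r ≥ 1`. [folklore] -/
theorem one_le_mul_armProb_criticalProbI {r : ℕ} (hr : 1 ≤ r) :
    1 ≤ 588 * (r : ℝ) ^ 2 * armProb (criticalProbI 3) r := by
  have h := armProb_criticalProbI_ge hr
  have hpos : (0 : ℝ) < 588 * (r : ℝ) ^ 2 := by
    have : (0 : ℝ) < r := by exact_mod_cast hr
    positivity
  rwa [div_le_iff₀' hpos] at h

/-! ## §2 The two provable slices of the stub, and the reduction to the missing window -/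

/-- For `1 ≤ n ≤ r` and `λ ≥ 2`: `r² ≤ n² (r/n)^λ`. [folklore] -/
theorem sq_le_sq_mul_rpow {n r : ℕ} (hn : 1 ≤ n) (hnr : n ≤ r) {lam : ℝ} (hlam : 2 ≤ lam) :
    (r : ℝ) ^ 2 ≤ (n : ℝ) ^ 2 * ((r : ℝ) / n) ^ lam := by
  have hn0 : (0 : ℝ) < n := by exact_mod_cast hn
  have hrn1 : 1 ≤ (r : ℝ) / n := by
    rw [le_div_iff₀ hn0, one_mul]; exact_mod_cast hnr
  have h2 : ((r : ℝ) / n) ^ (2 : ℕ) ≤ ((r : ℝ) / n) ^ lam := by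
    rw [← Real.rpow_natCast]
    exact Real.rpow_le_rpow_of_exponent_le hrn1 (by exact_mod_cast hlam)
  have hsq : (r : ℝ) ^ 2 = (n : ℝ) ^ 2 * ((r : ℝ) / n) ^ (2 : ℕ) := by
    field_simp
  rw [hsq]
  exact mul_le_mul_of_nonneg_left h2 (by positivity)

/-- **Small-scale slice** (`n ≤ N₀`): `π_s(n) ≤ 588 N₀² (r/n)^λ π_s(r)` for `1 ≤ n ≤ N₀`, `n ≤ r`,
any `λ ≥ 2` — from `π_s(n) ≤ 1 ≤ 588 r² π_s(r)` and `r² ≤ n² (r/n)^λ ≤ N₀² (r/n)^λ`. [folklore] -/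
theorem wallArmLowerRegularity_small {lam : ℝ} (hlam : 2 ≤ lam) (N₀ : ℕ) :
    ∀ n r : ℕ, 1 ≤ n → n ≤ N₀ → n ≤ r →
      armProb (criticalProbI 3) n ≤
        588 * (N₀ : ℝ) ^ 2 * ((r : ℝ) / n) ^ lam * armProb (criticalProbI 3) r := by
  intro n r hn hnN hnr
  have hr : 1 ≤ r := hn.trans hnr
  have hπr := armProb_nonneg (criticalProbI 3) r
  have h1 := one_le_mul_armProb_criticalProbI hr
  have h2 := sq_le_sq_mul_rpow hn hnr hlam
  have h3 : (n : ℝ) ^ 2 ≤ (N₀ : ℝ) ^ 2 := by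
    have : (n : ℝ) ≤ N₀ := by exact_mod_cast hnN
    exact pow_le_pow_left₀ (by positivity) this 2
  have hX : 0 ≤ ((r : ℝ) / n) ^ lam := by positivity
  calc armProb (criticalProbI 3) n ≤ 1 := armProb_le_one _ _
    _ ≤ 588 * (r : ℝ) ^ 2 * armProb (criticalProbI 3) r := h1
    _ ≤ 588 * ((n : ℝ) ^ 2 * ((r : ℝ) / n) ^ lam) * armProb (criticalProbI 3) r := by gcongr
    _ ≤ 588 * ((N₀ : ℝ) ^ 2 * ((r : ℝ) / n) ^ lam) * armProb (criticalProbI 3) r := by gcongr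
    _ = 588 * (N₀ : ℝ) ^ 2 * ((r : ℝ) / n) ^ lam * armProb (criticalProbI 3) r := by ring

/-- **Far-scale slice** (`r ≥ n^{λ/(λ-2)}`, written `n^λ ≤ r^{λ-2}`): `π_s(n) ≤ 588 (r/n)^λ π_s(r)` —
from `π_s(n) ≤ 1 ≤ 588 r² π_s(r)` and `r² ≤ (r/n)^λ`. [folklore] -/
theorem wallArmLowerRegularity_far {lam : ℝ} :
    ∀ n r : ℕ, 1 ≤ n → n ≤ r → (n : ℝ) ^ lam ≤ (r : ℝ) ^ (lam - 2) →
      armProb (criticalProbI 3) n ≤ 588 * ((r : ℝ) / n) ^ lam * armProb (criticalProbI 3) r := by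
  intro n r hn hnr hfar
  have hr : 1 ≤ r := hn.trans hnr
  have hn0 : (0 : ℝ) < n := by exact_mod_cast hn
  have hr0 : (0 : ℝ) < r := by exact_mod_cast hr
  have hπr := armProb_nonneg (criticalProbI 3) r
  have h1 := one_le_mul_armProb_criticalProbI hr
  have hnl : 0 < (n : ℝ) ^ lam := Real.rpow_pos_of_pos hn0 lam
  have h2 : (r : ℝ) ^ 2 ≤ ((r : ℝ) / n) ^ lam := by
    rw [Real.div_rpow hr0.le hn0.le, le_div_iff₀ hnl]
    have hsplit : (r : ℝ) ^ lam = (r : ℝ) ^ 2 * (r : ℝ) ^ (lam - 2) := by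
      rw [← Real.rpow_natCast (r : ℝ) 2, ← Real.rpow_add hr0]; norm_num
    rw [hsplit]
    exact mul_le_mul_of_nonneg_left hfar (by positivity)
  calc armProb (criticalProbI 3) n ≤ 1 := armProb_le_one _ _
    _ ≤ 588 * (r : ℝ) ^ 2 * armProb (criticalProbI 3) r := h1
    _ ≤ 588 * ((r : ℝ) / n) ^ lam * armProb (criticalProbI 3) r := by gcongr

/-- **Reduction of the stub to its genuine two-scale window.** If for some `2 ≤ λ < 11/4`, `C` and
`N₀` the inequality `π_s(n) ≤ C (r/n)^λ π_s(r)` holds whenever `N₀ ≤ n ≤ r` and `r^{λ-2} < n^λ`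
(the window containing `r = 2n`, i.e. uniform doubling — the part no one-scale bound reaches), then
`stub_wallArmLowerRegularity` holds (with the same `λ` and constant `max C 0 + 588 (N₀² + 1)`).
[folklore] -/
theorem wallArmLowerRegularity_of_window {C lam : ℝ} {N₀ : ℕ} (h2 : 2 ≤ lam)
    (hlam : lam < (11 : ℝ) / 4)
    (h : ∀ n r : ℕ, N₀ ≤ n → n ≤ r → (r : ℝ) ^ (lam - 2) < (n : ℝ) ^ lam →
      armProb (criticalProbI 3) n ≤ C * ((r : ℝ) / n) ^ lam * armProb (criticalProbI 3) r) :
    ∃ C lam : ℝ, lam < (11 : ℝ) / 4 ∧ ∀ n r : ℕ, 1 ≤ n → n ≤ r →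
      armProb (criticalProbI 3) n ≤ C * ((r : ℝ) / n) ^ lam * armProb (criticalProbI 3) r := by
  refine ⟨max C 0 + 588 * ((N₀ : ℝ) ^ 2 + 1), lam, hlam, fun n r hn hnr => ?_⟩
  have hX : 0 ≤ ((r : ℝ) / n) ^ lam * armProb (criticalProbI 3) r :=
    mul_nonneg (by positivity) (armProb_nonneg _ _)
  have hC0 : 0 ≤ max C 0 := le_max_right _ _
  -- every admissible constant is at most the chosen one
  have bump : ∀ K : ℝ, K ≤ max C 0 + 588 * ((N₀ : ℝ) ^ 2 + 1) →
      K * ((r : ℝ) / n) ^ lam * armProb (criticalProbI 3) r ≤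
        (max C 0 + 588 * ((N₀ : ℝ) ^ 2 + 1)) * ((r : ℝ) / n) ^ lam * armProb (criticalProbI 3) r := by
    intro K hK
    rw [mul_assoc, mul_assoc]
    exact mul_le_mul_of_nonneg_right hK hX
  rcases le_or_gt n N₀ with hnN | hNn
  · -- small scales
    exact (wallArmLowerRegularity_small h2 N₀ n r hn hnN hnr).trans (bump _ (by nlinarith))
  · rcases le_or_gt ((n : ℝ) ^ lam) ((r : ℝ) ^ (lam - 2)) with hfar | hwin
    · -- far scales
      exact (wallArmLowerRegularity_far n r hn hnr hfar).trans (bump _ (by nlinarith))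
    · -- the window: the hypothesis
      exact (h n r hNn.le hnr hwin).trans (bump _ (by nlinarith [le_max_left C 0]))

/-! ## §3 The gluing-free cross-scale handle: Harris–FKG supermultiplicativity of `τ_ℍ` -/

/-- `ℍ` is stable under translation by a vector of `ℍ`. [folklore] -/
theorem add_mem_Hs {a x : V3} (ha : a ∈ Hs) (hx : x ∈ Hs) : a + x ∈ Hs := by
  change (0 : ℤ) ≤ (a + x) 0
  have h1 : (0 : ℤ) ≤ a 0 := ha
  have h2 : (0 : ℤ) ≤ x 0 := hx
  rw [Pi.add_apply]; omega

/-- **Translation**: for `x ∈ ℍ`, `P_p(0 ↔_ℍ z) ≤ P_p(x ↔_ℍ x + z)` — the shift by `x` maps `ℍ` into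
`ℍ` and an open path of `ℍ` from `0` to `z` onto an open path of `x + ℍ ⊆ ℍ` from `x` to `x + z`
(`bondPercolation_real_preimage_shift`). [folklore] -/
theorem real_conn_le_real_openConnIn_shift (p : unitInterval) {x : V3} (hx : x ∈ Hs) (z : V3) :
    (Pp p).real (conn z) ≤ (Pp p).real (openConnIn Hs x (x + z)) := by
  have key : (BondConfig.relabel (sym2Equiv (Site.shift (-x)))) ⁻¹' (conn z) ⊆
      openConnIn Hs x (x + z) := by
    intro ω hω
    rw [Set.mem_preimage, conn, DCT16.mem_openConnIn_iff_pathIn] at hω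
    have hAB : ∀ a ∈ Hs, (fun a : V3 => a + x) a ∈ Hs := fun a ha => add_mem_Hs ha hx
    have hadj : ∀ a b : V3, a ∈ Hs → b ∈ Hs →
        (openGraph (BondConfig.relabel (sym2Equiv (Site.shift (-x))) ω)).Adj a b →
          (openGraph ω).Adj ((fun a : V3 => a + x) a) ((fun a : V3 => a + x) b) := by
      intro a b _ _ hab
      have hiff := openGraph_relabel_adj_iff (Site.shift (-x)) ω (a + x) (b + x)
      rw [Site.shift_apply, Site.shift_apply, add_neg_cancel_right, add_neg_cancel_right] at hiff
      exact hiff.1 hab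
    have hmap := DCT16.pathIn_map (G' := openGraph ω) (fun a : V3 => a + x) hAB hadj hω
    rw [DCT16.mem_openConnIn_iff_pathIn]
    simpa [add_comm] using hmap
  calc (Pp p).real (conn z)
      = (bondPercolation (zdGraph 3) p).real
          ((BondConfig.relabel (sym2Equiv (Site.shift (-x)))) ⁻¹' (conn z)) :=
        (bondPercolation_real_preimage_shift (-x) p (conn z)).symm
    _ ≤ (Pp p).real (openConnIn Hs x (x + z)) := measureReal_mono key

/-- **Harris–FKG supermultiplicativity of wall-rooted connections**: for `x ∈ ℍ` and any `z`,
`P_p(0 ↔_ℍ x) · P_p(0 ↔_ℍ z) ≤ P_p(0 ↔_ℍ x + z)` — both `{0 ↔_ℍ x}` and `{x ↔_ℍ x+z}` are increasing,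
their intersection is contained in `{0 ↔_ℍ x+z}`, and `P(x ↔_ℍ x+z) ≥ P(0 ↔_ℍ z)` by translation.
(The only cross-scale lower-bound mechanism available without RSW; it squares probabilities instead of
losing a constant, which is why it cannot give the stub.) [folklore] -/
theorem real_conn_mul_le_real_conn_add (p : unitInterval) {x : V3} (hx : x ∈ Hs) (z : V3) :
    (Pp p).real (conn x) * (Pp p).real (conn z) ≤ (Pp p).real (conn (x + z)) := by
  have hD_up : IsUpperSet (openConnIn Hs x (x + z)) := by
    rw [openConnIn_eq_openConnVia hx]; exact isUpperSet_openConnVia _ _ _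
  have hD_meas : MeasurableSet (openConnIn Hs x (x + z)) := measurableSet_openConnIn_of_countable _ _ _
  have hsub : conn x ∩ openConnIn Hs x (x + z) ⊆ conn (x + z) := fun ω hω =>
    SlabCriticality.openConnIn_trans hω.1 hω.2
  calc (Pp p).real (conn x) * (Pp p).real (conn z)
      ≤ (Pp p).real (conn x) * (Pp p).real (openConnIn Hs x (x + z)) :=
        mul_le_mul_of_nonneg_left (real_conn_le_real_openConnIn_shift p hx z) measureReal_nonneg
    _ ≤ (Pp p).real (conn x ∩ openConnIn Hs x (x + z)) :=
        harris_fkg_holds (zdGraph 3) p (isUpperSet_conn x) hD_up (measurableSet_conn x) hD_meas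
    _ ≤ (Pp p).real (conn (x + z)) := measureReal_mono hsub

/-- Multiples of a vector of `ℍ` stay in `ℍ`. [folklore] -/
theorem nsmul_mem_Hs {x : V3} (hx : x ∈ Hs) : ∀ k : ℕ, k • x ∈ Hs
  | 0 => by rw [zero_nsmul]; exact zero_mem_Hs
  | k + 1 => by rw [succ_nsmul]; exact add_mem_Hs (nsmul_mem_Hs hx k) hx

/-- Iterated supermultiplicativity: `P_p(0 ↔_ℍ x)^{k+1} ≤ P_p(0 ↔_ℍ (k+1)x)` for `x ∈ ℍ`. [folklore] -/
theorem real_conn_pow_le (p : unitInterval) {x : V3} (hx : x ∈ Hs) :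
    ∀ k : ℕ, (Pp p).real (conn x) ^ (k + 1) ≤ (Pp p).real (conn ((k + 1) • x))
  | 0 => by simp
  | k + 1 => by
    calc (Pp p).real (conn x) ^ (k + 1 + 1)
        = (Pp p).real (conn x) ^ (k + 1) * (Pp p).real (conn x) := pow_succ _ _
      _ ≤ (Pp p).real (conn ((k + 1) • x)) * (Pp p).real (conn x) :=
          mul_le_mul_of_nonneg_right (real_conn_pow_le p hx k) measureReal_nonneg
      _ ≤ (Pp p).real (conn ((k + 1) • x + x)) :=
          real_conn_mul_le_real_conn_add p (nsmul_mem_Hs hx (k + 1)) x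
      _ = (Pp p).real (conn ((k + 1 + 1) • x)) := by rw [succ_nsmul _ (k + 1)]

/-- A wall-rooted connection to sup-distance `≥ n` is a tall event: `P_p(0 ↔_ℍ x) ≤ π_p(n)` for
`‖x‖∞ ≥ n`. [folklore] -/
theorem real_conn_le_armProb (p : unitInterval) {x : V3} {n : ℕ} (hxn : n ≤ snorm x) :
    (Pp p).real (conn x) ≤ armProb p n :=
  measureReal_mono fun ω hω => ⟨x, far_iff_snorm.2 hxn, hω⟩

/-! ## §4 Registered form of the window reduction (binder-free statement, for the item's sub-goal registry) -/

/-- **Window reduction, registered form**: the stub `stub_wallArmLowerRegularity` follows from its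
restriction to the two-scale window `N₀ ≤ n ≤ r`, `r^{λ-2} < n^λ` (any `2 ≤ λ < 11/4`, any `C`, `N₀`).
Binder-free restatement of `wallArmLowerRegularity_of_window`. [folklore] -/
theorem wallArmLowerRegularity_window_reduction :
    ∀ (C lam : ℝ) (N₀ : ℕ), 2 ≤ lam → lam < (11 : ℝ) / 4 →
      (∀ n r : ℕ, N₀ ≤ n → n ≤ r → (r : ℝ) ^ (lam - 2) < (n : ℝ) ^ lam →
        armProb (criticalProbI 3) n ≤ C * ((r : ℝ) / n) ^ lam * armProb (criticalProbI 3) r) →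
      ∃ C lam : ℝ, lam < (11 : ℝ) / 4 ∧ ∀ n r : ℕ, 1 ≤ n → n ≤ r →
        armProb (criticalProbI 3) n ≤ C * ((r : ℝ) / n) ^ lam * armProb (criticalProbI 3) r :=
  fun _ _ _ h2 hlam h => wallArmLowerRegularity_of_window h2 hlam h

end Summit.CriticalPhenomena.PercolationContinuityZ3.Theorems.TallClusterMassBound.ReplicaOverlap
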